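import Summits.AtomisticToContinuum.BoseEinsteinCondensation.Theses.BECCellInformation
import Summits.AtomisticToContinuum.BoseEinsteinCondensation.Theorems.BECCellInformationCellInformationBoundStubVarianceToInformation

/-!
# Route `BECCellInformation`, crux `CellInformationBound` (stmt-AtomisticToContinuum-13439):
# the crux follows from the χ²-mutual-information (cell-variance) bound

Supports (does not close) stmt-AtomisticToContinuum-13439.  This is the composition of the registered
line `Lines/birth.lean` ("information is dominated by variance") with its information-theoretic stub
discharged: `stub_varianceToInformation` (KL ≤ χ² for the cell functionals, every trial state) is the
landed theorem `CellInformationBound.stub_varianceToInformation`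
(`BECCellInformationCellInformationBoundStubVarianceToInformation.lean`), so the crux
`CellInformationBound` (the N-uniform bound on the coarse mutual information
`∫ dY Σ_k m(Y) P_k klFun(A_k(Y)/(m(Y) P_k))` for non-negative `δ`-near-minimisers of the dilute
Dirichlet Bose gas) is implied by the single remaining stub of the line, the **χ²-mutual-information
bound** `∫ dY Σ_k (A_k(Y) − m(Y) P_k)²/(m(Y) P_k) ≤ C` in the same quantifier frame
(`= E_Y χ²(Q(·|Y) ‖ P) = Σ_k Var_m(Q_k)/P_k`, the relative variance across cells of the
cell-integrated conditional intensity of the tagged boson — Reatto's insertion field averaged over a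
cell).  The hypothesis is stated verbatim as the registered signature of `stub_cellVarianceBound`
(open: it carries the physics of the crux, one notch stronger); the proof is quantifier plumbing plus
`le_trans` with the fixed-state inequality.

References: T. M. Cover, J. A. Thomas, *Elements of Information Theory* (2005), Lemma 11.6.1
(`D ≤ χ²`); L. Reatto, Phys. Rev. 183 (1969) 334 (test-particle / insertion-field picture).
-/

namespace Summit.AtomisticToContinuum.BoseEinsteinCondensation.Theorems.CellInformationBound

/-- **`CellInformationBound` from the χ²-mutual-information bound.**  If for every repulsive
finite-range `v` there is `ρ₀ > 0` such that for `0 < ρ < ρ₀` there are `l > 0` and `C` with: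
eventually in `n`, for some `δ > 0`, every non-negative `δ`-near-minimiser `Ψ ∈ TrialState (n+1) L`,
`L = sideLength ρ (n+1)`, has `∫⁻ dY ofReal(Σ_k (A_k(Y) − m(Y) P_k)²/(m(Y) P_k)) ≤ ofReal C` (cells of
side `L/⌈L/l⌉₊`), then the route's crux `CellInformationBound` holds (same `ρ₀, l, C, δ`), because the
mutual-information integrand is dominated termwise by the `χ²`-integrand
(`stub_varianceToInformation`). [cite: CoverThomas2005, Lemma 11.6.1] -/
theorem cellInformationBound_of_cellVarianceBound :
    (∀ v : ℝ → ENNReal, Literature.MathematicalPhysics.QuantumManyBody.BoseGas.IsRepulsiveFiniteRange v → ∃ ρ₀ : ℝ, 0 < ρ₀ ∧ ∀ ρ : ℝ, 0 < ρ → ρ < ρ₀ → ∃ l : ℝ, 0 < l ∧ ∃ C : ℝ, ∀ᶠ n : ℕ in Filter.atTop, ∃ δ : ENNReal, 0 < δ ∧ ∀ Ψ : Literature.MathematicalPhysics.QuantumManyBody.BoseGas.TrialState (n + 1) (Literature.MathematicalPhysics.QuantumManyBody.BoseGas.sideLength ρ (n + 1)), Literature.MathematicalPhysics.QuantumManyBody.BoseGas.energy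 v Ψ ≤ Literature.MathematicalPhysics.QuantumManyBody.BoseGas.groundStateEnergy v (n + 1) (Literature.MathematicalPhysics.QuantumManyBody.BoseGas.sideLength ρ (n + 1)) + δ → (∀ X, Ψ.ψ X = (‖Ψ.ψ X‖ : ℂ)) → ∫⁻ Y : Literature.MathematicalPhysics.QuantumManyBody.BoseGas.Config n, ENNReal.ofReal (∑ k : Fin 3 → Fin ⌈Literature.MathematicalPhysics.QuantumManyBody.BoseGas.sideLength ρ (n + 1) / l⌉₊, ((∫ x in {y : EuclideanSpace ℝ (Fin 3) | ∀ j, y j ∈ Set.Ico (((k j : ℕ) : ℝ) * (Literature.MathematicalPhysics.QuantumManyBody.BoseGas.sideLength ρ (n + 1) / (⌈Literature.MathematicalPhysics.QuantumManyBody.BoseGas.sideLength ρ (n + 1) / l⌉₊ : ℝ))) ((((k j : ℕ) : ℝ) + 1) * (Literature.MathematicalPhysics.QuantumManyBody.BoseGas.sideLength ρ (n + 1) / (⌈Literature.MathematicalPhysics.QuantumManyBody.BoseGas.sideLength ρ (n + 1) / l⌉₊ : ℝ)))}, ‖Ψ.ψ (Matrix.vecCons x Y)‖ ^ 2) - (∫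 z, ‖Ψ.ψ (Matrix.vecCons z Y)‖ ^ 2) * (∫ Y' : Literature.MathematicalPhysics.QuantumManyBody.BoseGas.Config n, ∫ x in {y : EuclideanSpace ℝ (Fin 3) | ∀ j, y j ∈ Set.Ico (((k j : ℕ) : ℝ) * (Literature.MathematicalPhysics.QuantumManyBody.BoseGas.sideLength ρ (n + 1) / (⌈Literature.MathematicalPhysics.QuantumManyBody.BoseGas.sideLength ρ (n + 1) / l⌉₊ : ℝ))) ((((k j : ℕ) : ℝ) + 1) * (Literature.MathematicalPhysics.QuantumManyBody.BoseGas.sideLength ρ (n + 1) / (⌈Literature.MathematicalPhysics.QuantumManyBody.BoseGas.sideLength ρ (n + 1) / l⌉₊ : ℝ)))}, ‖Ψ.ψ (Matrix.vecCons x Y')‖ ^ 2)) ^ 2 / ((∫ z, ‖Ψ.ψ (Matrix.vecCons z Y)‖ ^ 2) * (∫ Y' : Literature.MathematicalPhysics.QuantumManyBody.BoseGas.Config n, ∫ x in {y : EuclideanSpace ℝ (Fin 3) | ∀ j, y j ∈ Set.Ico (((k j : ℕ) : ℝ) * (Literature.MathematicalPhysics.QuantumManyBody.BoseGas.sideLength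 ρ (n + 1) / (⌈Literature.MathematicalPhysics.QuantumManyBody.BoseGas.sideLength ρ (n + 1) / l⌉₊ : ℝ))) ((((k j : ℕ) : ℝ) + 1) * (Literature.MathematicalPhysics.QuantumManyBody.BoseGas.sideLength ρ (n + 1) / (⌈Literature.MathematicalPhysics.QuantumManyBody.BoseGas.sideLength ρ (n + 1) / l⌉₊ : ℝ)))}, ‖Ψ.ψ (Matrix.vecCons x Y')‖ ^ 2))) ≤ ENNReal.ofReal C) → Summit.AtomisticToContinuum.BoseEinsteinCondensation.Theses.BECCellInformation.CellInformationBound := by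
  intro hA v hv
  obtain ⟨ρ₀, hρ₀, H⟩ := hA v hv
  refine ⟨ρ₀, hρ₀, fun ρ hρ hρlt => ?_⟩
  obtain ⟨l, hl, C, hev⟩ := H ρ hρ hρlt
  refine ⟨l, hl, C, ?_⟩
  filter_upwards [hev] with n hn
  obtain ⟨δ, hδ, hΨ⟩ := hn
  exact ⟨δ, hδ, fun Ψ hE hpos => le_trans (stub_varianceToInformation n _ _ Ψ) (hΨ Ψ hE hpos)⟩

end Summit.AtomisticToContinuum.BoseEinsteinCondensation.Theorems.CellInformationBound
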